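import Literature.NumberTheory.Transcendental.NesterenkoSplitNorm
import Literature.NumberTheory.Transcendental.NesterenkoEliminationZerosK
import Literature.NumberTheory.Transcendental.NesterenkoChowFormPrime
import Literature.NumberTheory.Transcendental.NesterenkoEliminationProp47Proofs
import Mathlib.FieldTheory.IsAlgClosed.AlgebraicClosure
import Mathlib.FieldTheory.Galois.Infinite
import HarnessLib

/-!
# The `u`-resultant of the Chow form of a prime with a form, I: splitting over `ℚ(u₁, …, u_s)‾` and Galois descent (towards LNM 1752 Ch. 3 Prop. 4.11, route B)

`Literature/NumberTheory/Transcendental/NesterenkoUResultant.lean`. Second step of the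
specialisation route to the named fact `NesterenkoPhilippon2001_ch3_prop_4_11`
(Nesterenko–Philippon (eds.), LNM 1752 (2001), Ch. 3 Prop. 4.11 = [Nes10, Prop. 1.4]). Let
`𝔭 ⊂ ℚ[x₀, …, x_m]` be a homogeneous prime with `dim ℚ[x̲]/𝔭 = s + 1` (`s = dim 𝔭 ≥ 0`),
`F = chowForm 𝔭 (s + 1) ∈ ℚ[u₁, …, u_{s+1}]` its associated form, `D = deg 𝔭`. Write
`A = ℚ[u₁, …, u_s]` (`RU s m`), `K' = Frac A` (`KU s m`), `Ω = K'‾` (`ΩU s m`), and read `F` as a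
form of degree `D` in the last group `u_{s+1}` with coefficients in `A ⊂ Ω` (`splitLast`,
`chowFormΩ`). We prove:

* `eval_map_splitLast` — `F(z; v) = F(z₁, …, z_s, v)` for any specialisation `z` of `u₁, …, u_s`
  and `v` of `u_{s+1}` in a `ℚ`-algebra; `isHomogeneous_map_splitLast_chowForm` — `F(z; ·)` is a
  form of degree `D`;
* `exists_split_chowFormΩ` — **`F = c ∏_{i<D} (β⁽ⁱ⁾ · u_{s+1})` over `Ω`** with `c ≠ 0` and every
  `β⁽ⁱ⁾ ∈ Ω^{m+1} ∖ 0` a zero of `𝔭` on the generic hyperplanes `u₁, …, u_s` (the zeros theorem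
  `aeval_chowForm_eq_zero_iff_of_isAlgClosed` of `NesterenkoEliminationZerosK.lean` and the
  splitting `exists_eq_C_mul_prod_linK` of `NesterenkoFormsOnHyperplanesK.lean`) — the generic
  linear section of `V(𝔭)` (Hodge–Pedoe X §7);
* `uResΩ` — the `u`-RESULTANT `c^d ∏ Q₀(β⁽ⁱ⁾) ∈ Ω` of `𝔭` with an integer form `Q₀` of degree
  `d` ([Nes10] Prop. 1.4: `a^{deg Q} ∏ Q(β⁽ᵏ⁾)`), independent of the splitting
  (`uResΩ_eq_splitNorm`, from `splitNorm_eq_of_eq`);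
* `uResΩ_mem_range_algebraMap` — **Galois descent**: `uResΩ ∈ K'` (every `K'`-automorphism of `Ω`
  permutes the lines `[β⁽ⁱ⁾]`, so fixes `uResΩ`; `Ω/K'` is Galois in characteristic `0`,
  `InfiniteGalois.mem_range_algebraMap_iff_fixed`).

That `uResΩ` actually lies in `A` (and has integer coefficients when `F`, `Q₀` do) is the
valuation-theoretic content of the sequel `NesterenkoUResultantIntegral.lean`.

Definitions here are plumbing with bodies (`splitLast`, `lastCombine`, `KU`, `ΩU`, `uΩ`,
`chowFormΩ`, `secPoints`, `uResΩ`); no named facts.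

## References

* [NesterenkoPhilippon2001] Yu. V. Nesterenko, P. Philippon (eds.), *Introduction to Algebraic
  Independence Theory*, LNM 1752, Springer 2001, Ch. 3 §4, Prop. 4.4 (p. 38), Prop. 4.11
  (pp. 40–41; PDF pp. 52–53).
* [Nes10] Yu. V. Nesterenko, Proc. Steklov Inst. Math. 218 (1997) 294–331, Prop. 1.4.
* [HodgePedoe1994] W. V. D. Hodge, D. Pedoe, *Methods of Algebraic Geometry* II, Ch. X §§6–8.
-/

noncomputable section

open MvPolynomial

attribute [local instance] MvPolynomial.gradedAlgebra

namespace Literature.NumberTheory.Transcendental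

namespace Nesterenko

variable {m : ℕ}

/-! ### Splitting off the last group of variables -/

/-- Joining values `z` of the first `s` groups `u₁, …, u_s` and `v` of the last group `u_{s+1}`
into one point of `L^{(s+1)(m+1)}`. [folklore] -/
def lastCombine {L : Type*} {s : ℕ} (z : Fin s × Fin (m + 1) → L) (v : Fin (m + 1) → L) :
    Fin (s + 1) × Fin (m + 1) → L :=
  fun w => Fin.lastCases (motive := fun _ => L) (v w.2) (fun i => z (i, w.2)) w.1

/-- `lastCombine` on the last group. [folklore] -/
@[simp] theorem lastCombine_last {L : Type*} {s : ℕ} (z : Fin s × Fin (m + 1) → L)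
    (v : Fin (m + 1) → L) (j : Fin (m + 1)) : lastCombine z v (Fin.last s, j) = v j := by
  simp [lastCombine]

/-- `lastCombine` on the first `s` groups. [folklore] -/
@[simp] theorem lastCombine_castSucc {L : Type*} {s : ℕ} (z : Fin s × Fin (m + 1) → L)
    (v : Fin (m + 1) → L) (i : Fin s) (j : Fin (m + 1)) :
    lastCombine z v (Fin.castSucc i, j) = z (i, j) := by
  simp [lastCombine]

/-- `F(u₁, …, u_{s+1}) ↦ F` read as a polynomial in the last group `u_{s+1} = (x₀, …, x_m)` with
coefficients in `ℚ[u₁, …, u_s]`. [folklore] -/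
def splitLast (s m : ℕ) : RU (s + 1) m →ₐ[ℚ] MvPolynomial (Fin (m + 1)) (RU s m) :=
  aeval fun w : Fin (s + 1) × Fin (m + 1) =>
    lastCombine (fun v : Fin s × Fin (m + 1) => (C (X v) : MvPolynomial (Fin (m + 1)) (RU s m)))
      (fun j => X j) w

/-- `splitLast` on a variable of the last group. [folklore] -/
@[simp] theorem splitLast_X_last (s : ℕ) (j : Fin (m + 1)) :
    splitLast s m (X (Fin.last s, j)) = X j := by
  simp [splitLast]

/-- `splitLast` on a variable of the first `s` groups. [folklore] -/
@[simp] theorem splitLast_X_castSucc (s : ℕ) (i : Fin s) (j : Fin (m + 1)) :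
    splitLast s m (X (Fin.castSucc i, j)) = C (X (i, j)) := by
  simp [splitLast]

/-- Putting the last group back: the left inverse of `splitLast`. [folklore] -/
def unsplitLast (s m : ℕ) : MvPolynomial (Fin (m + 1)) (RU s m) →+* RU (s + 1) m :=
  eval₂Hom ((rename (R := ℚ) fun v : Fin s × Fin (m + 1) => (Fin.castSucc v.1, v.2)) :
      RU s m →ₐ[ℚ] RU (s + 1) m).toRingHom
    fun j => X (Fin.last s, j)

/-- `unsplitLast ∘ splitLast = id`. [folklore] -/
theorem unsplitLast_splitLast (s : ℕ) (F : RU (s + 1) m) :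
    unsplitLast s m (splitLast s m F) = F := by
  have key : (unsplitLast s m).comp
      (splitLast s m : RU (s + 1) m →+* MvPolynomial (Fin (m + 1)) (RU s m)) = RingHom.id _ := by
    refine ringHom_ext (fun q => ?_) (fun w => ?_)
    · change unsplitLast s m (splitLast s m (C q)) = C q
      rw [splitLast, aeval_C, MvPolynomial.algebraMap_apply, MvPolynomial.algebraMap_eq,
        unsplitLast, eval₂Hom_C, AlgHom.toRingHom_eq_coe, RingHom.coe_coe, rename_C]
    · obtain ⟨i, j⟩ := w
      change unsplitLast s m (splitLast s m (X (i, j))) = X (i, j)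
      induction i using Fin.lastCases with
      | last => rw [splitLast_X_last, unsplitLast, eval₂Hom_X']
      | cast i =>
        rw [splitLast_X_castSucc, unsplitLast, eval₂Hom_C, AlgHom.toRingHom_eq_coe,
          RingHom.coe_coe, rename_X]
  exact RingHom.congr_fun key F

/-- `splitLast` is injective. [folklore] -/
theorem splitLast_injective (s m : ℕ) : Function.Injective (splitLast s m) :=
  Function.LeftInverse.injective (unsplitLast_splitLast (m := m) s)

/-- **Evaluation of the split form**: specialising the coefficients `u₁, …, u_s ↦ z` (a ring
homomorphism `φ` with `φ(u_{ij}) = z_{ij}`) and then the variables `u_{s+1} ↦ v` is evaluating `F`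
at the joint point. [folklore] -/
theorem eval_map_splitLast {L : Type*} [CommRing L] [Algebra ℚ L] {s : ℕ}
    (φ : RU s m →ₐ[ℚ] L) (v : Fin (m + 1) → L) (F : RU (s + 1) m) :
    eval v (MvPolynomial.map (φ : RU s m →+* L) (splitLast s m F)) =
      aeval (lastCombine (fun w => φ (X w)) v) F := by
  have key : ((eval v).comp (MvPolynomial.map (φ : RU s m →+* L))).comp
      (splitLast s m : RU (s + 1) m →+* MvPolynomial (Fin (m + 1)) (RU s m)) =
      ((aeval (R := ℚ) (lastCombine (fun w => φ (X w)) v) : RU (s + 1) m →ₐ[ℚ] L) :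
        RU (s + 1) m →+* L) := by
    refine ringHom_ext (fun q => ?_) (fun w => ?_)
    · change eval v (MvPolynomial.map (φ : RU s m →+* L) (splitLast s m (C q))) = aeval _ (C q)
      rw [splitLast, aeval_C, MvPolynomial.algebraMap_apply, MvPolynomial.algebraMap_eq, map_C,
        eval_C, aeval_C]
      exact φ.commutes q
    · obtain ⟨i, j⟩ := w
      induction i using Fin.lastCases with
      | last => simp
      | cast i => simp
  exact RingHom.congr_fun key F

/-- Block-homogeneity in the last group becomes homogeneity: if `F` is weighted-homogeneous of
weight `n` for the indicator weight of the group `u_{s+1}`, then `F(z; ·)` is a form of degree `n`.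
[folklore] -/
theorem isHomogeneous_map_splitLast {L : Type*} [CommRing L] {s : ℕ} (φ : RU s m →+* L)
    {F : RU (s + 1) m} {n : ℕ}
    (hF : IsWeightedHomogeneous
      (fun w : Fin (s + 1) × Fin (m + 1) => if w.1 = Fin.last s then (1 : ℕ) else 0) F n) :
    (MvPolynomial.map φ (splitLast s m F)).IsHomogeneous n := by
  classical
  -- first `splitLast F` is homogeneous of degree `n` over `RU s m`
  suffices h : (splitLast s m F).IsHomogeneous n by
    intro e he
    rw [coeff_map] at he
    exact h (fun h0 => he (by rw [h0, map_zero]))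
  rw [F.as_sum, map_sum]
  refine IsHomogeneous.sum _ _ _ fun γ hγ => ?_
  rw [splitLast, aeval_monomial, MvPolynomial.algebraMap_apply, Finsupp.prod]
  have hw : Finsupp.weight (fun w : Fin (s + 1) × Fin (m + 1) =>
      if w.1 = Fin.last s then (1 : ℕ) else 0) γ = n := hF (mem_support_iff.mp hγ)
  have hψ : ∀ w : Fin (s + 1) × Fin (m + 1),
      (lastCombine (fun v : Fin s × Fin (m + 1) => (C (X v) : MvPolynomial (Fin (m + 1)) (RU s m)))
        (fun j => X j) w).IsHomogeneous (if w.1 = Fin.last s then 1 else 0) := by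
    rintro ⟨i, j⟩
    induction i using Fin.lastCases with
    | last => simpa using isHomogeneous_X (RU s m) j
    | cast i => simpa [Fin.castSucc_ne_last] using isHomogeneous_C _ (X (i, j) : RU s m)
  have hprod := IsHomogeneous.prod γ.support
    (fun w => (lastCombine (fun v : Fin s × Fin (m + 1) =>
      (C (X v) : MvPolynomial (Fin (m + 1)) (RU s m))) (fun j => X j) w) ^ γ w)
    (fun w => (if w.1 = Fin.last s then 1 else 0) * γ w) fun w _ => (hψ w).pow (γ w)
  have hsum : ∑ w ∈ γ.support, (if w.1 = Fin.last s then 1 else 0) * γ w = n := by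
    rw [← hw, Finsupp.weight_apply, Finsupp.sum]
    exact Finset.sum_congr rfl fun w _ => by rw [smul_eq_mul, mul_comm]
  rw [hsum] at hprod
  exact hprod.C_mul _

/-! ### The Chow form over `Ω = ℚ(u₁, …, u_s)‾` -/

/-- `K' = ℚ(u₁, …, u_s)`, the field of the generic `s` hyperplanes. [folklore] -/
abbrev KU (s m : ℕ) : Type := FractionRing (RU s m)

/-- `Ω = K'‾`, an algebraic closure of `ℚ(u₁, …, u_s)`. [folklore] -/
abbrev ΩU (s m : ℕ) : Type := AlgebraicClosure (KU s m)

/-- The generic hyperplanes `u₁, …, u_s` as points of `Ω`. [folklore] -/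
def uΩ (s m : ℕ) : Fin s × Fin (m + 1) → ΩU s m := fun w => algebraMap (RU s m) (ΩU s m) (X w)

/-- The structure map `A = ℚ[u₁, …, u_s] → Ω` is injective. [folklore] -/
theorem algebraMap_ΩU_injective (s m : ℕ) :
    Function.Injective (algebraMap (RU s m) (ΩU s m)) := by
  rw [IsScalarTower.algebraMap_eq (RU s m) (KU s m) (ΩU s m)]
  exact (algebraMap (KU s m) (ΩU s m)).injective.comp (IsFractionRing.injective (RU s m) (KU s m))

/-- `aeval uΩ` is the structure map `A → Ω`. [folklore] -/
theorem aeval_uΩ (s m : ℕ) :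
    (aeval (uΩ s m) : RU s m →ₐ[ℚ] ΩU s m) = IsScalarTower.toAlgHom ℚ (RU s m) (ΩU s m) := by
  refine algHom_ext fun w => ?_
  simp [uΩ]

/-- The associated form of `𝔭` read over `Ω` as a form in the last group:
`F_Ω(v) = F(u₁, …, u_s, v)`. [cite: NesterenkoPhilippon2001, Ch. 3 Prop. 4.4 (p. 38)] -/
def chowFormΩ (𝔭 : Ideal (Rx m)) (s : ℕ) : MvPolynomial (Fin (m + 1)) (ΩU s m) :=
  MvPolynomial.map (algebraMap (RU s m) (ΩU s m)) (splitLast s m (chowForm 𝔭 (s + 1)))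

/-- `F_Ω(v) = F(u₁, …, u_s, v)`. [folklore] -/
theorem eval_chowFormΩ (𝔭 : Ideal (Rx m)) (s : ℕ) (v : Fin (m + 1) → ΩU s m) :
    eval v (chowFormΩ 𝔭 s) = aeval (lastCombine (uΩ s m) v) (chowForm 𝔭 (s + 1)) := by
  have h := eval_map_splitLast (IsScalarTower.toAlgHom ℚ (RU s m) (ΩU s m)) v (chowForm 𝔭 (s + 1))
  rw [IsScalarTower.coe_toAlgHom'] at h
  exact h

/-- The points of `V(𝔭)` on the generic hyperplanes `u₁, …, u_s`: non-zero `β ∈ Ω^{m+1}` with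
`P(β) = 0` (`P ∈ 𝔭`) and `uᵢ · β = 0` (`i ≤ s`) — the generic linear section of `V(𝔭)`.
[cite: NesterenkoPhilippon2001, Ch. 3 Prop. 4.11 (pp. 40–41)] -/
def secPoints (𝔭 : Ideal (Rx m)) (s : ℕ) : Set (Fin (m + 1) → ΩU s m) :=
  {β | β ≠ 0 ∧ (∀ P ∈ 𝔭, aeval β P = 0) ∧ ∀ i : Fin s, ∑ j, β j * uΩ s m (i, j) = 0}

section Prime

variable {s : ℕ} {𝔭 : Ideal (Rx m)}

/-- Hypotheses of this section packaged: `𝔭` is a homogeneous prime with `dim ℚ[x̲]/𝔭 = s + 1`.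
We use them as separate hypotheses `(h𝔭 : 𝔭.IsPrime)`,
`(hhom : 𝔭.IsHomogeneous _)`, `(hdim : ringKrullDim (Rx m ⧸ 𝔭) = (s + 1 : ℕ))`. [folklore] -/
theorem chowForm_ne_zero_of_prime (h𝔭 : 𝔭.IsPrime)
    (hhom : 𝔭.IsHomogeneous (homogeneousSubmodule (Fin (m + 1)) ℚ))
    (hdim : ringKrullDim (Rx m ⧸ 𝔭) = (s + 1 : ℕ)) : chowForm 𝔭 (s + 1) ≠ 0 :=
  haveI := h𝔭
  (span_chowForm_eq_elimIdeal 𝔭 hhom (Nat.succ_pos s) hdim).2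

/-- `F_Ω ≠ 0`. [folklore] -/
theorem chowFormΩ_ne_zero (h𝔭 : 𝔭.IsPrime)
    (hhom : 𝔭.IsHomogeneous (homogeneousSubmodule (Fin (m + 1)) ℚ))
    (hdim : ringKrullDim (Rx m ⧸ 𝔭) = (s + 1 : ℕ)) : chowFormΩ 𝔭 s ≠ 0 := by
  intro h
  apply chowForm_ne_zero_of_prime h𝔭 hhom hdim
  have h1 : splitLast s m (chowForm 𝔭 (s + 1)) = 0 :=
    map_injective _ (algebraMap_ΩU_injective s m) (by rw [map_zero]; exact h)
  exact splitLast_injective s m (by rw [h1, map_zero])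

/-- `F_Ω` is a form of degree `D = deg 𝔭` in `u_{s+1}`. [cite: NesterenkoPhilippon2001, Ch. 3,
remark after Prop. 4.4 (p. 38)] -/
theorem isHomogeneous_chowFormΩ (𝔭 : Ideal (Rx m)) (s : ℕ) :
    (chowFormΩ 𝔭 s).IsHomogeneous (ideg 𝔭 (s + 1)) :=
  isHomogeneous_map_splitLast _ (chowForm_isWeightedHomogeneous 𝔭 (Nat.succ_pos s) (Fin.last s))

/-- `deg F_Ω = D`. [folklore] -/
theorem totalDegree_chowFormΩ (h𝔭 : 𝔭.IsPrime)
    (hhom : 𝔭.IsHomogeneous (homogeneousSubmodule (Fin (m + 1)) ℚ))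
    (hdim : ringKrullDim (Rx m ⧸ 𝔭) = (s + 1 : ℕ)) :
    (chowFormΩ 𝔭 s).totalDegree = ideg 𝔭 (s + 1) :=
  (isHomogeneous_chowFormΩ 𝔭 s).totalDegree (chowFormΩ_ne_zero h𝔭 hhom hdim)

/-- **The zeros of `F_Ω`**: `F(u₁, …, u_s, v) = 0` iff the hyperplane `v` passes through a point
of the generic linear section. [cite: NesterenkoPhilippon2001, Ch. 3 Prop. 4.4 (p. 38)] -/
theorem eval_chowFormΩ_eq_zero_iff (h𝔭 : 𝔭.IsPrime)
    (hhom : 𝔭.IsHomogeneous (homogeneousSubmodule (Fin (m + 1)) ℚ))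
    (hdim : ringKrullDim (Rx m ⧸ 𝔭) = (s + 1 : ℕ)) (v : Fin (m + 1) → ΩU s m) :
    eval v (chowFormΩ 𝔭 s) = 0 ↔ ∃ β ∈ secPoints 𝔭 s, ∑ j, β j * v j = 0 := by
  haveI := h𝔭
  have hpr : (elimIdeal 𝔭 (s + 1)).IsPrincipal := by
    haveI : Infinite ℚ := Infinite.of_injective (Nat.cast : ℕ → ℚ) Nat.cast_injective
    obtain ⟨h1, -, -⟩ := NesterenkoK.isPrincipal_elimIdeal 𝔭 hhom (Nat.succ_pos s) hdim
    rwa [← elimIdeal_eq] at h1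
  rw [eval_chowFormΩ, aeval_chowForm_eq_zero_iff_of_isAlgClosed hhom hpr]
  constructor
  · rintro ⟨β, hβ0, hβI, hL⟩
    refine ⟨β, ⟨hβ0, hβI, fun i => ?_⟩, ?_⟩
    · have h := hL (Fin.castSucc i)
      simp only [lastCombine_castSucc] at h
      rw [← h]
      exact Finset.sum_congr rfl fun j _ => mul_comm _ _
    · have h := hL (Fin.last s)
      simp only [lastCombine_last] at h
      rw [← h]
      exact Finset.sum_congr rfl fun j _ => mul_comm _ _
  · rintro ⟨β, ⟨hβ0, hβI, hU⟩, hv⟩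
    refine ⟨β, hβ0, hβI, fun i => ?_⟩
    induction i using Fin.lastCases with
    | last =>
      simp only [lastCombine_last]
      rw [← hv]
      exact Finset.sum_congr rfl fun j _ => mul_comm _ _
    | cast i =>
      simp only [lastCombine_castSucc]
      rw [← hU i]
      exact Finset.sum_congr rfl fun j _ => mul_comm _ _

/-- **Splitting of the Chow form over the generic linear section** (Hodge–Pedoe X §7): over
`Ω = ℚ(u₁, …, u_s)‾`, `F(u₁, …, u_s, ·) = c ∏_{i < deg 𝔭} (β⁽ⁱ⁾ · u_{s+1})` with `c ≠ 0` and
every `β⁽ⁱ⁾` a point of `V(𝔭)` on the hyperplanes `u₁, …, u_s`.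
[cite: NesterenkoPhilippon2001, Ch. 3 Prop. 4.11 (pp. 40–41)] -/
theorem exists_split_chowFormΩ (h𝔭 : 𝔭.IsPrime)
    (hhom : 𝔭.IsHomogeneous (homogeneousSubmodule (Fin (m + 1)) ℚ))
    (hdim : ringKrullDim (Rx m ⧸ 𝔭) = (s + 1 : ℕ)) :
    ∃ c : ΩU s m, c ≠ 0 ∧ ∃ β : Fin (ideg 𝔭 (s + 1)) → (Fin (m + 1) → ΩU s m),
      (∀ i, β i ∈ secPoints 𝔭 s) ∧ chowFormΩ 𝔭 s = C c * ∏ i, (∑ j, C (β i j) * X j) := by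
  have hW0 : ∀ β ∈ secPoints 𝔭 s, β ≠ 0 := fun β hβ => hβ.1
  obtain ⟨c, hc, β, hβ, heq⟩ := exists_eq_C_mul_prod_linK (chowFormΩ_ne_zero h𝔭 hhom hdim) hW0
    (fun β hβ u hu => (eval_chowFormΩ_eq_zero_iff h𝔭 hhom hdim u).mpr ⟨β, hβ, hu⟩)
    (fun u hu => (eval_chowFormΩ_eq_zero_iff h𝔭 hhom hdim u).mp hu)
  -- reindex `Fin (totalDegree) → Fin D`
  have hD := totalDegree_chowFormΩ h𝔭 hhom hdim
  refine ⟨c, hc, fun i => β (Fin.cast hD.symm i), fun i => hβ _, heq.trans ?_⟩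
  congr 1
  exact Fintype.prod_equiv (finCongr hD) _ _ (fun i => by simp)

/-! ### The `u`-resultant over `Ω` -/

/-- A chosen splitting constant `c` of `F_Ω` (junk `0` when `𝔭` is not a homogeneous prime of
dimension `s`). [folklore] -/
def splitConst (𝔭 : Ideal (Rx m)) (s : ℕ) : ΩU s m :=
  open Classical in
  if h : ∃ c : ΩU s m, c ≠ 0 ∧ ∃ β : Fin (ideg 𝔭 (s + 1)) → (Fin (m + 1) → ΩU s m),
      (∀ i, β i ∈ secPoints 𝔭 s) ∧ chowFormΩ 𝔭 s = C c * ∏ i, (∑ j, C (β i j) * X j)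
  then h.choose else 0

/-- Chosen points `β⁽ⁱ⁾`, `i < deg 𝔭`, of the generic linear section with
`F_Ω = splitConst · ∏ (β⁽ⁱ⁾ · u_{s+1})` (junk `0` otherwise). [folklore] -/
def splitPts (𝔭 : Ideal (Rx m)) (s : ℕ) : Fin (ideg 𝔭 (s + 1)) → (Fin (m + 1) → ΩU s m) :=
  open Classical in
  if h : ∃ c : ΩU s m, c ≠ 0 ∧ ∃ β : Fin (ideg 𝔭 (s + 1)) → (Fin (m + 1) → ΩU s m),
      (∀ i, β i ∈ secPoints 𝔭 s) ∧ chowFormΩ 𝔭 s = C c * ∏ i, (∑ j, C (β i j) * X j)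
  then h.choose_spec.2.choose else 0

/-- The defining properties of `splitConst`, `splitPts`. [folklore] -/
theorem splitConst_spec (h𝔭 : 𝔭.IsPrime)
    (hhom : 𝔭.IsHomogeneous (homogeneousSubmodule (Fin (m + 1)) ℚ))
    (hdim : ringKrullDim (Rx m ⧸ 𝔭) = (s + 1 : ℕ)) :
    splitConst 𝔭 s ≠ 0 ∧ (∀ i, splitPts 𝔭 s i ∈ secPoints 𝔭 s) ∧
      chowFormΩ 𝔭 s = C (splitConst 𝔭 s) * ∏ i, (∑ j, C (splitPts 𝔭 s i j) * X j) := by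
  classical
  have h := exists_split_chowFormΩ h𝔭 hhom hdim
  simp only [splitConst, splitPts, dif_pos h]
  exact ⟨h.choose_spec.1, h.choose_spec.2.choose_spec.1, h.choose_spec.2.choose_spec.2⟩

/-- **The `u`-resultant of `𝔭` with an integer form `Q₀` of degree `d`, over `Ω`**:
`res = c^d ∏_{i < deg 𝔭} Q₀(β⁽ⁱ⁾)` for the splitting `F_Ω = c ∏ (β⁽ⁱ⁾ · u_{s+1})`
([Nes10] Prop. 1.4: `a^{deg Q} ∏ₖ Q(β̄⁽ᵏ⁾)`). [cite: NesterenkoPhilippon2001, Ch. 3 Prop. 4.11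
(pp. 40–41)] -/
def uResΩ (𝔭 : Ideal (Rx m)) (s d : ℕ) (Q₀ : MvPolynomial (Fin (m + 1)) ℤ) : ΩU s m :=
  splitNorm d Q₀ (splitConst 𝔭 s) (splitPts 𝔭 s)

/-- **Independence of the splitting**: for ANY splitting `F_Ω = c' ∏_{i<D'} (β'⁽ⁱ⁾ · u)` into
non-zero vectors, `res = c'^d ∏ Q₀(β'⁽ⁱ⁾)`. [folklore] -/
theorem uResΩ_eq_splitNorm (h𝔭 : 𝔭.IsPrime)
    (hhom : 𝔭.IsHomogeneous (homogeneousSubmodule (Fin (m + 1)) ℚ))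
    (hdim : ringKrullDim (Rx m ⧸ 𝔭) = (s + 1 : ℕ)) {d : ℕ} {Q₀ : MvPolynomial (Fin (m + 1)) ℤ}
    (hQ : Q₀.IsHomogeneous d) {D' : ℕ} {c' : ΩU s m} {β' : Fin D' → (Fin (m + 1) → ΩU s m)}
    (hβ' : ∀ i, β' i ≠ 0) (heq : chowFormΩ 𝔭 s = C c' * ∏ i, (∑ j, C (β' i j) * X j)) :
    uResΩ 𝔭 s d Q₀ = splitNorm d Q₀ c' β' := by
  obtain ⟨hc, hβ, hF⟩ := splitConst_spec h𝔭 hhom hdim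
  exact splitNorm_eq_of_eq hQ (fun i => (hβ i).1) hβ' hc (hF.symm.trans heq)

/-! ### Galois descent: the `u`-resultant lies in `K' = ℚ(u₁, …, u_s)` -/

/-- A `K'`-automorphism of `Ω` fixes the image of `A = ℚ[u₁, …, u_s]`. [folklore] -/
theorem algEquiv_apply_algebraMap (f : ΩU s m ≃ₐ[KU s m] ΩU s m) (a : RU s m) :
    f (algebraMap (RU s m) (ΩU s m) a) = algebraMap (RU s m) (ΩU s m) a := by
  rw [IsScalarTower.algebraMap_apply (RU s m) (KU s m) (ΩU s m), AlgEquiv.commutes]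

/-- A `K'`-automorphism of `Ω` fixes `F_Ω` coefficientwise. [folklore] -/
theorem map_algEquiv_chowFormΩ (f : ΩU s m ≃ₐ[KU s m] ΩU s m) :
    MvPolynomial.map (f : ΩU s m →+* ΩU s m) (chowFormΩ 𝔭 s) = chowFormΩ 𝔭 s := by
  rw [chowFormΩ, map_map]
  exact congrArg (fun g => MvPolynomial.map g (splitLast s m (chowForm 𝔭 (s + 1))))
    (RingHom.ext fun a => algEquiv_apply_algebraMap f a)

/-- A `K'`-automorphism maps points of the generic section to points of the generic section.
[folklore] -/
theorem algEquiv_mem_secPoints (f : ΩU s m ≃ₐ[KU s m] ΩU s m) {β : Fin (m + 1) → ΩU s m}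
    (hβ : β ∈ secPoints 𝔭 s) : (fun j => f (β j)) ∈ secPoints 𝔭 s := by
  obtain ⟨h0, hI, hU⟩ := hβ
  refine ⟨?_, fun P hP => ?_, fun i => ?_⟩
  · intro h
    apply h0
    funext j
    have := congrFun h j
    simpa using this
  · have e : aeval (fun j => f (β j)) P = f (aeval β P) :=
      (comp_aeval_apply (f := β) (φ := (f : ΩU s m ≃ₐ[KU s m] ΩU s m).toAlgHom.restrictScalars ℚ)
        (p := P)).symm
    rw [e, hI P hP, map_zero]
  · have h := congrArg f (hU i)
    rw [map_zero, map_sum] at h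
    rw [← h]
    refine Finset.sum_congr rfl fun j _ => ?_
    rw [map_mul, uΩ, algEquiv_apply_algebraMap]

/-- **Galois invariance of the `u`-resultant**: `f(res) = res` for every `K'`-automorphism `f` of
`Ω` (apply `f` to the splitting and use its independence of the splitting). [folklore] -/
theorem algEquiv_uResΩ (h𝔭 : 𝔭.IsPrime)
    (hhom : 𝔭.IsHomogeneous (homogeneousSubmodule (Fin (m + 1)) ℚ))
    (hdim : ringKrullDim (Rx m ⧸ 𝔭) = (s + 1 : ℕ)) {d : ℕ} {Q₀ : MvPolynomial (Fin (m + 1)) ℤ}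
    (hQ : Q₀.IsHomogeneous d) (f : ΩU s m ≃ₐ[KU s m] ΩU s m) :
    f (uResΩ 𝔭 s d Q₀) = uResΩ 𝔭 s d Q₀ := by
  obtain ⟨hc, hβ, hF⟩ := splitConst_spec h𝔭 hhom hdim
  change (f : ΩU s m →+* ΩU s m) (splitNorm d Q₀ (splitConst 𝔭 s) (splitPts 𝔭 s)) = _
  rw [map_splitNorm (f : ΩU s m →+* ΩU s m)]
  symm
  refine uResΩ_eq_splitNorm h𝔭 hhom hdim hQ (c' := (f : ΩU s m →+* ΩU s m) (splitConst 𝔭 s))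
    (β' := fun i j => (f : ΩU s m →+* ΩU s m) (splitPts 𝔭 s i j))
    (fun i => (algEquiv_mem_secPoints f (hβ i)).1) ?_
  calc chowFormΩ 𝔭 s = MvPolynomial.map (f : ΩU s m →+* ΩU s m) (chowFormΩ 𝔭 s) :=
        (map_algEquiv_chowFormΩ f).symm
    _ = _ := by rw [hF, map_C_mul_prod_lin]

/-- **Galois descent**: the `u`-resultant lies in `K' = ℚ(u₁, …, u_s)` (`Ω/K'` is Galois in
characteristic `0` and `res` is fixed by its group). [folklore] -/
theorem uResΩ_mem_range_algebraMap (h𝔭 : 𝔭.IsPrime)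
    (hhom : 𝔭.IsHomogeneous (homogeneousSubmodule (Fin (m + 1)) ℚ))
    (hdim : ringKrullDim (Rx m ⧸ 𝔭) = (s + 1 : ℕ)) {d : ℕ} {Q₀ : MvPolynomial (Fin (m + 1)) ℤ}
    (hQ : Q₀.IsHomogeneous d) :
    uResΩ 𝔭 s d Q₀ ∈ Set.range (algebraMap (KU s m) (ΩU s m)) :=
  (InfiniteGalois.mem_range_algebraMap_iff_fixed _).mpr fun f => algEquiv_uResΩ h𝔭 hhom hdim hQ f

end Prime

end Nesterenko

end Literature.NumberTheory.Transcendental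

end
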